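import Summits.BirchSwinnertonDyer.BirchSwinnertonDyer.Theorems.EisensteinPrimesFullDescentAssembly
import Summits.BirchSwinnertonDyer.BirchSwinnertonDyer.Theorems.EisensteinPrimesFullDescentLemmaSOmega
import Summits.BirchSwinnertonDyer.BirchSwinnertonDyer.Theorems.EisensteinPrimesLineCharactersAtMultiplicativePlaceTwo
import Literature.NumberTheory.EllipticCurves.KellerYin2024.AnomalousCongruenceFullDescentDatum
import HarnessLib

/-!
# Route `EisensteinPrimes`, crux 2 `GoodLatticeBDPValue` (stmt-BirchSwinnertonDyer-19032), line `halves`, road R5 / AN-5 —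
# **THE ASSEMBLY SHELL OF T‴** (the `5 ≤ p` twin of stub 3a-B / Theorem T′ `stub_fullDescentAtThreeOfRed`):
# a full-descent datum at every good Eisenstein prime `p ≥ 5` under the good-lattice normalisation, from three global pieces

Cell `bsd-eis` (home `run/shared/lean/pub/bsd-eis/`), width seat `bsd-line-x1-p1-w7` (gen 7; `--supports -19032`, closes
nothing by itself). Road R5 (HOME STATUS 2026-08-28 21:34Z) makes the composed-print name
`KellerYin2024.thm222_anacong_goodLattice_of_five_le` a corollary of 3a-A `…_of_fullDescentDatum` through the kernel theorem
T‴: for `W/ℚ` globally minimal, `5 ≤ p` good with `E[p]` reducible and EVERY rational `p`-line ramified at `p` (the crux's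
normalisation binder `∀ Φ, IsRationalLine W p Φ → ¬ LineUnramifiedAt W p Φ`), EITHER an additive prime exists OR a multiplicative
prime `ℓ` exists that is split with `ℓ ≡ 1 (mod p)` or non-split with `ℓ + 1 ≡ 0 (mod p)` — Ribet–Yoo necessity for `E/ℚ`
(Yoo 2019 Thm. 1.3), proved along w3 gen 4's elementary road (`HOME/line-x1-p1-w3-g4/AN3-StubB-elementary-road.md`) at level
`p`/`p²`, CASE ω only. THIS FILE is the `p`-version of LEAD g5's `FullDescentAssembly.fullDescentAtThreeOfRed_of_pieces`
(p656167): it proves T‴, token for token, from ONE global piece stated as a hypothesis in the currency the bricks use —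

* `hA` — **Theorem A_p** (A-I_p this seat + A-II_p seat w3 g13; Case `ω` ⇒ ⊥): `p` odd good ordinary, every place `v ∤ p`
  good or SPLIT multiplicative with `ℓ_v ≢ 1 (mod p)`, and a `Q ≠ 0` of `E[p]` on which `Γ_ℚ` acts through `χ̄_p` ⟹ `False`;

— and from TREE THEOREMS for everything else: **LS-ω_p** (seat w5 g6, `FullDescentLemmaSOmega.lineCharacter_eq_modNCyclotomic
Character`, p671741: the ramified rational `p`-line of a semistable good ordinary curve is the `ω`-line), the reducibility
dictionary (`Mazur1978.not_hasIrreducibleModPGaloisRep_iff_exists_natCard_eq`, `exists_isogenyCharacter`, the shape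
`(r *; 0 χ̄ r⁻¹)`), ordinarity of a good Eisenstein `p` (`Rank1Residual.goodOrd_of_red_of_good`), the prime/place dictionary over
`ℚ`, and the LOCAL step L2 — **a non-split multiplicative `ℓ ≠ p` under an `ω`-line has `ℓ ≡ −1 (mod p)`**, EVERY prime `ℓ`
including `2` — which is x2-p1-w7's `lineChars_natCast_of_not_hasSplitMultiplicativeReductionAtPrime` (twisted Tate curve:
`{φ(ℓ), ψ(ℓ)} = {−ℓ, −1}`) in seat w6 g8's all-`ℓ` form `…AtPrime'` (brick G2, the `ℓ = 2` flip of the `p = 2` cell), read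
on the `ω`-line (`φ = χ̄_p`, `ψ = 𝟙`).

§5 `thm222_anacong_goodLattice_of_five_le_of_fullDescentDatum_of_datum` is the BRIDGE (pure logic): T‴ (as a hypothesis `hT`, the
conclusion of `fullDescentDatum_of_theoremA`) and 3a-A `KellerYin2024.thm222_anacong_goodLattice_of_fullDescentDatum` imply the
composed-print name `KellerYin2024.thm222_anacong_goodLattice_of_five_le` — the count-reducing reading of the road.

Logic of `fullDescentDatum_of_theoremA`: if some prime is additive we are done; else `W` is semistable; if no multiplicative prime
carries the datum then every place `∤ p` is good or split with `ℓ ≢ 1 (mod p)` (non-split `ℓ` ⇒ `ℓ ≡ −1` contradicts); the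
rational line (from `Red`) is ramified at `p` (normalisation), so has character `χ̄_p` (LS-ω_p) ⇒ ⊥ (`hA`).

HONEST FRAMING: a sorry-free CONDITIONAL assembly (the hypothesis `hA` is the open brick Theorem A_p of the road, being proved by
the width seats; when it lands the seat instantiates this theorem and the bridge `_of_five_le ⟸ _of_fullDescentDatum` closes BY
NAME). 0 definitions, 0 named facts, 0 sorry. No summit statement, no BSD / IMC / Keller–Yin theorem, no stub of the registered
skeleton is proved here. References: [Yoo2019] H. Yoo, *Non-optimal levels of a reducible mod ℓ modular representation*, Trans.
AMS 371 (2019), Thm. 1.3; [Kriz2016] Thm. 34 (1)–(3), Thm. 35, Def. 31, Rem. 32–33; [SerreInventiones1972] §1.11 Prop. 12;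
[Mazur1978] §5 (pp. 148–152); [GreenbergVatsal2000] §2 pp. 14–15; [SilvermanATAEC1994] V.5.3, Cor. 5.4, Ex. 5.11.
-/

set_option autoImplicit false

-- the route's Theorems namespace repeats the summit name by design (D-0017 nested layout)
set_option linter.dupNamespace false

noncomputable section

open scoped Classical NumberField

namespace Summit.BirchSwinnertonDyer.BirchSwinnertonDyer.Theorems.FullDescentAssemblyPrime

open NumberField IsDedekindDomain Field WeierstrassCurve Rat.HeightOneSpectrum
  Literature.NumberTheory.EllipticCurves Literature.NumberTheory.GaloisRepresentations
  Literature.NumberTheory.EllipticCurves.Rank1Residual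
  Summit.BirchSwinnertonDyer.BirchSwinnertonDyer.Theorems.EisensteinPrimesLineCharactersAtMultiplicativePlace
open Summit.BirchSwinnertonDyer.BirchSwinnertonDyer.Theorems.FullDescentLemmaSOmega (isRationalLine_zmultiples
  lineCharacter_eq_modNCyclotomicCharacter)

/-! ## §1. Small arithmetic in `ℤ/p` -/

/-- `(ℓ : ℤ/p) = −1` means `ℓ + 1 ≡ 0 (mod p)`. [folklore] -/
theorem add_one_modEq_zero_of_natCast_eq_neg_one {p ℓ : ℕ} (h : (ℓ : ZMod p) = -1) : ℓ + 1 ≡ 0 [MOD p] := by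
  rw [Nat.modEq_zero_iff_dvd, ← ZMod.natCast_eq_zero_iff, Nat.cast_add, Nat.cast_one, h, neg_add_cancel]

/-- In `ℤ/p`, `p` an odd prime, `1 ≠ −1`. [folklore] -/
theorem one_ne_neg_one_zmod {p : ℕ} [hp : Fact p.Prime] (hp2 : p ≠ 2) : (1 : ZMod p) ≠ -1 := by
  haveI : Fact (2 < p) := ⟨lt_of_le_of_ne hp.out.two_le (Ne.symm hp2)⟩
  exact (ZMod.neg_one_ne_one (n := p)).symm

/-! ## §2. The rational line `⟨P⟩` and the two character shapes used by the local dichotomy -/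

variable {W : WeierstrassCurve ℚ} [W.IsElliptic] {p : ℕ} [hp : Fact p.Prime]

omit [W.IsElliptic] in
/-- On the line `⟨P⟩`, `Γ_ℚ` acts through the character `r` of `P`: `σ Q = r(σ) Q` for every `Q ∈ ⟨P⟩`. [folklore] -/
theorem smul_eq_of_mem_zmultiples {P : geomTorsion W (p : ℤ)}
    {r : absoluteGaloisGroup ℚ →* (ZMod p)ˣ}
    (hr : ∀ σ : absoluteGaloisGroup ℚ, σ • P = ((r σ : (ZMod p)ˣ) : ZMod p).val • P)
    (σ : absoluteGaloisGroup ℚ) {Q : geomTorsion W (p : ℤ)} (hQ : Q ∈ AddSubgroup.zmultiples P) :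
    σ • Q = ((r σ : (ZMod p)ˣ) : ZMod p).val • Q := by
  obtain ⟨k, rfl⟩ := AddSubgroup.mem_zmultiples_iff.mp hQ
  have h1 : σ • (k • P) = k • (σ • P) := map_zsmul (DistribSMul.toAddMonoidHom _ σ) k P
  rw [h1, hr σ, smul_comm]

/-- The `(r *; 0 χ̄_p r⁻¹)` shape on `E[p]/⟨P⟩`, with the mod `p` cyclotomic character under its tree name
`modNCyclotomicCharacter`. [cite: Mazur1978, §5 (p. 148) and §6 proof of Prop. 6.3 (p. 153)] -/
theorem smul_sub_smul_mem_zmultiples {P : geomTorsion W (p : ℤ)} (hP0 : P ≠ 0)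
    {r : absoluteGaloisGroup ℚ →* (ZMod p)ˣ}
    (hr : ∀ σ : absoluteGaloisGroup ℚ, σ • P = ((r σ : (ZMod p)ˣ) : ZMod p).val • P)
    (σ : absoluteGaloisGroup ℚ) (S : geomTorsion W (p : ℤ)) :
    σ • S - (((modNCyclotomicCharacter ℚ p σ : (ZMod p)ˣ) : ZMod p) *
        (((r σ)⁻¹ : (ZMod p)ˣ) : ZMod p)).val • S ∈ AddSubgroup.zmultiples P :=
  Mazur1978.smul_sub_smul_mem_zmultiples_of_isogenyCharacter W p hP0 hr σ S

/-! ## §3. L2 of the road on the `ω`-line: a NON-split multiplicative `ℓ ≠ p` has `ℓ ≡ −1 (mod p)` -/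

/-- **A non-split multiplicative prime `ℓ ≠ p` of a curve carrying an `ω`-line in `E[p]` has `ℓ + 1 ≡ 0 (mod p)`** (every `ℓ`,
also `ℓ = 2`). At the place `v = (ℓ)` the twisted Tate curve gives `{φ(ℓ), ψ(ℓ)} = {−ℓ, −1}` for the line character `φ` and the
quotient character `ψ` (x2-p1-w7's `lineChars_natCast_of_not_hasSplitMultiplicativeReductionAtPrime` in w6 g8's all-`ℓ` form
`…AtPrime'`); on the `ω`-line `(φ, ψ) = (χ̄_p, 𝟙)`, so `ψ(ℓ) = 1 ≠ −1` (`p` odd) forces `φ(ℓ) = ℓ = −1`. [cite: Kriz2016, Thm. 34 (2)]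
[cite: GreenbergVatsal2000, §2 pp. 14–15] [cite: SilvermanATAEC1994, Ch. V Thm. 5.3, Cor. 5.4, Ex. 5.11] -/
theorem add_one_modEq_zero_of_not_split_of_omega [W.IsGloballyMinimal] (hp2 : p ≠ 2)
    {P : geomTorsion W (p : ℤ)} (hP0 : P ≠ 0)
    (hω : ∀ σ : absoluteGaloisGroup ℚ, σ • P = ((modNCyclotomicCharacter ℚ p σ : (ZMod p)ˣ) : ZMod p).val • P)
    (v : HeightOneSpectrum (𝓞 ℚ)) (hvp : natGenerator v ≠ p)
    (hmult : haveI := Fact.mk (primesEquiv v).2; W.HasMultiplicativeReductionAtPrime (primesEquiv v : ℕ))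
    (hns : haveI := Fact.mk (primesEquiv v).2; ¬ W.HasSplitMultiplicativeReductionAtPrime (primesEquiv v : ℕ)) :
    natGenerator v + 1 ≡ 0 [MOD p] := by
  haveI hℓ : Fact (primesEquiv v : ℕ).Prime := Fact.mk (primesEquiv v).2
  have hv : ((primesEquiv v : Nat.Primes) : ℕ) = natGenerator v := rfl
  have hΦ := isRationalLine_zmultiples hP0 (r := modNCyclotomicCharacter ℚ p) hω
  -- `ℓ` is a unit mod `p`
  have hℓp : ¬ natGenerator v ∣ p := fun h ↦
    hvp ((Nat.prime_dvd_prime_iff_eq (prime_natGenerator v) hp.out).mp h)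
  have hu : IsUnit ((natGenerator v : ℕ) : ZMod p) := by
    rw [← ZMod.coe_unitOfCoprime (natGenerator v) ((Nat.coprime_primes (prime_natGenerator v)
      hp.out).mpr (fun h ↦ hvp h))]
    exact Units.isUnit _
  obtain ⟨u, hu'⟩ := hu
  -- the identity Dirichlet character mod `p` with values in `ℤ/p`
  set idχ : DirichletCharacter (ZMod p) p := MulChar.ofUnitHom (MonoidHom.id (ZMod p)ˣ) with hidχ
  have hidχ_apply : ∀ w : (ZMod p)ˣ, idχ (w : ZMod p) = (w : ZMod p) := fun w ↦ by
    rw [hidχ, MulChar.ofUnitHom_coe, MonoidHom.id_apply]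
  have hone_ℓ1 : (1 : DirichletCharacter (ZMod p) 1) ((natGenerator v : ℕ) : ZMod 1) = 1 :=
    MulChar.one_apply (isUnit_of_subsingleton _)
  -- the `ω`-line: `φ = χ̄_p` (mod p), `ψ = 𝟙` (mod 1)
  have hφ0 : ∀ σ : absoluteGaloisGroup ℚ, ∀ Q ∈ AddSubgroup.zmultiples P,
      σ • Q = (idχ ((modNCyclotomicCharacter ℚ p σ : (ZMod p)ˣ) : ZMod p)).val • Q := by
    intro σ Q hQ
    rw [hidχ_apply, smul_eq_of_mem_zmultiples hω σ hQ]
  have hψ0 : ∀ (σ : absoluteGaloisGroup ℚ) (Q : geomTorsion W (p : ℤ)),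
      σ • Q - ((1 : DirichletCharacter (ZMod p) 1)
        ((modNCyclotomicCharacter ℚ 1 σ : (ZMod 1)ˣ) : ZMod 1)).val • Q ∈ AddSubgroup.zmultiples P := by
    intro σ Q
    have h := smul_sub_smul_mem_zmultiples hP0 hω σ Q
    have hval : ((1 : DirichletCharacter (ZMod p) 1)
        ((modNCyclotomicCharacter ℚ 1 σ : (ZMod 1)ˣ) : ZMod 1)).val =
          (((modNCyclotomicCharacter ℚ p σ : (ZMod p)ˣ) : ZMod p) *
            (((modNCyclotomicCharacter ℚ p σ)⁻¹ : (ZMod p)ˣ) : ZMod p)).val := by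
      rw [MulChar.one_apply_coe, Units.mul_inv]
    rwa [← hval] at h
  rcases lineChars_natCast_of_not_hasSplitMultiplicativeReductionAtPrime' (p := p) hv hvp hmult hns hΦ
      idχ hℓp (1 : DirichletCharacter (ZMod p) 1) (fun h ↦ (prime_natGenerator v).ne_one (Nat.dvd_one.mp h)) hφ0 hψ0
    with ⟨-, hψ⟩ | ⟨-, hψ⟩
  · rw [hone_ℓ1] at hψ
    exact absurd hψ (one_ne_neg_one_zmod hp2)
  · rw [hone_ℓ1] at hψ
    exact add_one_modEq_zero_of_natCast_eq_neg_one (neg_eq_iff_eq_neg.mp hψ.symm)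

/-! ## §4. The assembly: T‴ from Theorem A_p -/

/-- **T‴ (the `5 ≤ p` twin of stub 3a-B `stub_fullDescentAtThreeOfRed`) ASSEMBLED from Theorem A_p** (`hA`: Case `ω` ⇒ ⊥ under
«`p` odd good ordinary, every place `∤ p` good or split with `ℓ ≢ 1 (mod p)`») and tree theorems (LS-ω_p: the ramified rational
`p`-line of a semistable curve good ordinary at `p` is the `ω`-line; reducibility dictionary; ordinarity of a good Eisenstein `p`;
prime/place dictionary; the local step L2 `add_one_modEq_zero_of_not_split_of_omega`, all `ℓ`). The conclusion is the full-descent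
datum of `KellerYin2024.thm222_anacong_goodLattice_of_fullDescentDatum` under four binders of `…_of_five_le`, token for token.
[cite: Yoo2019, Thm. 1.3] [cite: Kriz2016, Thm. 34 (1)–(3), Thm. 35, Def. 31, Rem. 32–33] [cite: SerreInventiones1972, §1.11 Prop. 12]
[cite: Mazur1978, §5 (pp. 148–152)] -/
theorem fullDescentDatum_of_theoremA
    (hA : ∀ (W : WeierstrassCurve ℚ) [W.IsElliptic] [W.IsGloballyMinimal] (p : ℕ) [Fact p.Prime],
      p ≠ 2 → W.HasGoodReductionAtPrime p → ¬ (p : ℤ) ∣ W.frobeniusTrace p →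
      (∀ v : HeightOneSpectrum (𝓞 ℚ), natGenerator v ≠ p →
        W.HasGoodReductionAt v ∨ (W.HasSplitMultiplicativeReductionAt v ∧ ¬ natGenerator v ≡ 1 [MOD p])) →
      ∀ Q : geomTorsion W (p : ℤ), Q ≠ 0 →
        (∀ σ : absoluteGaloisGroup ℚ, σ • Q = ((modNCyclotomicCharacter ℚ p σ : (ZMod p)ˣ) : ZMod p).val • Q) →
        False) :
    ∀ (W : WeierstrassCurve ℚ) [W.IsElliptic] [W.IsGloballyMinimal] (p : ℕ) [Fact p.Prime],
      5 ≤ p → Good W p → Red W p →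
      (∀ Φ : AddSubgroup (geomTorsion W (p : ℤ)), IsRationalLine W p Φ → ¬ LineUnramifiedAt W p Φ) →
      ((∃ (ℓ : ℕ) (hℓ : ℓ.Prime), haveI : Fact ℓ.Prime := ⟨hℓ⟩; Addv W ℓ) ∨
        (∃ (ℓ : ℕ) (hℓ : ℓ.Prime), haveI : Fact ℓ.Prime := ⟨hℓ⟩;
          W.HasMultiplicativeReductionAtPrime ℓ ∧
            ((W.HasSplitMultiplicativeReductionAtPrime ℓ ∧ ℓ ≡ 1 [MOD p]) ∨
              (¬ W.HasSplitMultiplicativeReductionAtPrime ℓ ∧ ℓ + 1 ≡ 0 [MOD p])))) := by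
  intro W _ _ p _ h5 hgood hred hlat
  have hpp : p.Prime := Fact.out
  have hp2 : p ≠ 2 := by omega
  have h2p : 2 < p := by omega
  by_cases hadd : ∃ (ℓ : ℕ) (hℓ : ℓ.Prime), haveI : Fact ℓ.Prime := ⟨hℓ⟩; Addv W ℓ
  · exact Or.inl hadd
  right
  -- no additive prime: `W` is semistable
  have hsemi : Semistable W := by
    intro ℓ hℓ
    haveI : Fact ℓ.Prime := ⟨hℓ⟩
    by_contra h
    rw [not_or] at h
    exact hadd ⟨ℓ, hℓ, h⟩
  by_contra hno
  -- ordinarity of the good Eisenstein prime `p`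
  have hord : ¬ (p : ℤ) ∣ W.frobeniusTrace p := (goodOrd_of_red_of_good W p h2p hgood hred).2
  -- the rational line and its isogeny character
  obtain ⟨H, hHst, hHcard⟩ := (Mazur1978.not_hasIrreducibleModPGaloisRep_iff_exists_natCard_eq W p).mp hred
  obtain ⟨P, hP0, rfl⟩ := Mazur1978.exists_eq_zmultiples_of_natCard_eq W p hHcard
  obtain ⟨r, hr⟩ := Mazur1978.exists_isogenyCharacter W p hP0 (fun σ ↦ hHst σ P (AddSubgroup.mem_zmultiples P))
  -- the normalisation: the line is ramified at `p`, hence (LS-ω_p) it is the `ω`-line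
  have hnotunr : ¬ LineUnramifiedAt W p (AddSubgroup.zmultiples P) := hlat _ (isRationalLine_zmultiples hP0 hr)
  have hω' := lineCharacter_eq_modNCyclotomicCharacter (W := W) (p := p) hp2 hgood hord hsemi hP0 hr hnotunr
  have hω : ∀ σ : absoluteGaloisGroup ℚ,
      σ • P = ((modNCyclotomicCharacter ℚ p σ : (ZMod p)ˣ) : ZMod p).val • P := fun σ ↦ by rw [hr σ, hω' σ]
  -- the local hypothesis H: every place `∤ p` is good, or split multiplicative with `ℓ ≢ 1 (mod p)`
  have hH : ∀ v : HeightOneSpectrum (𝓞 ℚ), natGenerator v ≠ p →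
      W.HasGoodReductionAt v ∨ (W.HasSplitMultiplicativeReductionAt v ∧ ¬ natGenerator v ≡ 1 [MOD p]) := by
    intro v hvp
    haveI hℓ : Fact (primesEquiv v : ℕ).Prime := Fact.mk (primesEquiv v).2
    have hv : ((primesEquiv v : Nat.Primes) : ℕ) = natGenerator v := rfl
    rcases hsemi (primesEquiv v : ℕ) (primesEquiv v).2 with hg | hm
    · exact Or.inl ((hasGoodReductionAtPrime_iff_hasGoodReductionAt_ringOfIntegers v W).mp hg)
    · right
      by_cases hsplit : W.HasSplitMultiplicativeReductionAtPrime (primesEquiv v : ℕ)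
      · refine ⟨Summit.BirchSwinnertonDyer.Rank1Residual.X2.GreenbergVatsalStrictSelmerMultiplicative.hasSplitMultiplicativeReductionAt_of_mem W
          (primesEquiv v : ℕ) hsplit (natCast_mem_asIdeal_of_primesEquiv_eq hv), ?_⟩
        intro h1
        exact hno ⟨(primesEquiv v : ℕ), (primesEquiv v).2, hm, Or.inl ⟨hsplit, h1⟩⟩
      · exact absurd ⟨(primesEquiv v : ℕ), (primesEquiv v).2, hm, Or.inr ⟨hsplit,
          add_one_modEq_zero_of_not_split_of_omega hp2 hP0 hω v hvp hm hsplit⟩⟩ hno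
  exact hA W p hp2 hgood hord hH P hP0 hω

/-! ## §5. The bridge: `_of_five_le` from 3a-A and T‴ (pure logic) -/

/-- **The count-reducing reading of road R5 (bookkeeping, no content):** given T‴ — a full-descent datum at every good
Eisenstein `p ≥ 5` under the good-lattice normalisation (hypothesis `hT`, the conclusion of `fullDescentDatum_of_theoremA`) — the
composed-print statement `KellerYin2024.thm222_anacong_goodLattice_of_five_le` (CGLS 2.2.1/2.2.2 ∘ Kriz Rem. 33 ∘ Hida at `5 ≤ p`)
FOLLOWS from 3a-A `KellerYin2024.thm222_anacong_goodLattice_of_fullDescentDatum` (the same composition GIVEN a datum): feed the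
datum. [cite: CastellaGrossiLeeSkinner2022, Thms. 2.2.1/2.2.2 with (2.16)] [cite: Kriz2016, Def. 31 (5), Rem. 33, Thm. 34 (3), Thm. 35]
[cite: Yoo2019, Thm. 1.3] -/
theorem thm222_anacong_goodLattice_of_five_le_of_fullDescentDatum_of_datum
    (hT : ∀ (W : WeierstrassCurve ℚ) [W.IsElliptic] [W.IsGloballyMinimal] (p : ℕ) [Fact p.Prime],
      5 ≤ p → Good W p → Red W p →
      (∀ Φ : AddSubgroup (geomTorsion W (p : ℤ)), IsRationalLine W p Φ → ¬ LineUnramifiedAt W p Φ) →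
      ((∃ (ℓ : ℕ) (hℓ : ℓ.Prime), haveI : Fact ℓ.Prime := ⟨hℓ⟩; Addv W ℓ) ∨
        (∃ (ℓ : ℕ) (hℓ : ℓ.Prime), haveI : Fact ℓ.Prime := ⟨hℓ⟩;
          W.HasMultiplicativeReductionAtPrime ℓ ∧
            ((W.HasSplitMultiplicativeReductionAtPrime ℓ ∧ ℓ ≡ 1 [MOD p]) ∨
              (¬ W.HasSplitMultiplicativeReductionAtPrime ℓ ∧ ℓ + 1 ≡ 0 [MOD p])))))
    (h3 : KellerYin2024.thm222_anacong_goodLattice_of_fullDescentDatum) :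
    KellerYin2024.thm222_anacong_goodLattice_of_five_le := by
  intro W _ _ p _ h5 hgood hred hanom hlat K _ _ hK hH hHp hodd hd3 htor ι v vbar hv hvbar hvne κ hκ γ _
    N _ Dt ι' hι' ΩK Ωp L hΩ hL θsub θquot hpair Sf hSf θK hθK Cbar hC ΩK' Ωp' Lφ hΩ' hLφ
  exact h3 W p (by omega) hgood hred hanom (hT W p h5 hgood hred hlat) hlat K hK hH hHp hodd hd3 htor ι v vbar hv hvbar
    hvne κ hκ γ N Dt ι' hι' ΩK Ωp L hΩ hL θsub θquot hpair Sf hSf θK hθK Cbar hC ΩK' Ωp' Lφ hΩ' hLφ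

end Summit.BirchSwinnertonDyer.BirchSwinnertonDyer.Theorems.FullDescentAssemblyPrime

end
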